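import Mathlib
import Summits.CriticalPhenomena.PercolationContinuityZ3.Theorems.PercNearOneGluingNoHeavyLowerTailSpiderGluingEpsDelta
import Summits.CriticalPhenomena.PercolationContinuityZ3.Theorems.PercNearOneGluingNoHeavyLowerTailForkedLegGoodness
import HarnessLib

/-!
# `NoHeavyLowerTail` (stmt-CriticalPhenomena-4575) — SPIDERS WHOSE LEGS END IN FORKS satisfy Kozma–Nitzan Conjecture 3,
# modulo the two-lonely-children gluing inequality GC at each fork (the typed socket of LEAD-GEN7 §7(vii))

Support file (depth prover `prim-nh-dp-blobmono` gen 8, 2026-08-19; `--supports stmt-CriticalPhenomena-4575`).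
No definitions, no named facts, no sorries.

A FORKED SPIDER: observer `o ∉ A`, relays `A ∋ b`; every neighbour of `o` is a relay or the start of a LEG — an injective chain
of non-relays avoiding `o` whose positive pairs towards non-relays go to chain neighbours (relay hairs arbitrary, so connector
legs are allowed), distinct legs vertex-disjoint — and the legs indexed by `F` have length `≥ 1` and end in a FORK: the tip is
joined, besides relays and its chain predecessor, to two pendant relay-stars `y x ≠ z x` (non-relays off every chain and every
other fork, positive pairs only towards `A ∪ {tip}`, any number of ports, any weights); relay side arbitrary.  HYPOTHESIS GC at
each fork `x ∈ F`: with `K_x := G ∖ ({o} ∪ leg_x)` (`restrW (insert o (range (p x)))ᶜ w`) and `a₀ x ∈ A` a minimiser of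
`P_{K_x}(· ↔ b)`,
  `P_{K_x+yz}(a₀ x ↔ b) ≤ P_{K_x+yz}(y x ↔ b) + Σ_{W ∩ A = ∅} P_{K_x+yz}(C(y x) = W) · min_a P_{(K_x+yz)∖W}(a ↔ b)`
(`K_x+yz` = the pair `y x – z x` made sure) — prim-hp-2's GC / Conjecture M instance, `prim-ineq-gen-7`'s `NEED({y,z})`, the lead's
two-lonely-children kernel LEAD-GEN7 §3a; a theorem when `a₀ x` is no lonelier in `K_x` than one of the two stars
(`KNGoodSeriesEasy.knGood_series_of_notLonelier`), open otherwise.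

* `forkedSpider_units` — the Steiner sets (chain ∪ fork) satisfy the unit hypotheses of `goodUnits_gluing`, every unit good in
  `G − o` (`knGood_of_chain`, `knGood_of_chain_fork`);
* `forkedSpider_gluing` — `H`-form: `μ(a ↮ b off o) ≤ t ∀a` ⇒ `μ(o ↔ A, o ↮ b) ≤ θ + t/θ` for every `θ > 0`;
* `forkedSpider_nearOneGluing` — `G`-form: `μ(a ↮ b) ≤ t ∀a` ⇒ `μ(o ↮ b) ≤ μ(o ↮ A) + 2 t^{1/4}`;
* `forkedSpider_conjecture3_explicit` — the `ε–δ` wording of the crux `NearOneGluing` on the class with `δ_ε = min(ε/2, (ε/4)^4)`.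
All uniform in `n`, the number of legs, their lengths, the forks' ports and `|A|`: on the tree line "spiders whose legs end in
forks" GC is the ONLY hypothesis left (SPIDER-GLUING Remark (c) made formal).
-/

namespace Summit.CriticalPhenomena.PercolationContinuityZ3.Theorems

open MeasureTheory Set
open Literature.Probability.LatticeModels (prodBernoulli)
open Literature.Probability.Percolation

noncomputable section
open Classical

variable {n : ℕ}

namespace SpiderGluing

open KNGoodAux

/-! ### 11. Forked spiders: the units, the `H`-form, the `G`-form and the `ε–δ` form -/

/-- **The legs of a FORKED SPIDER are good units, modulo GC at each fork.**  Observer `o`, relays `A ∋ b`, units `X`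
(the neighbours of `o`), forked leg starts `F ⊆ X ∖ A`.  Every non-relay `x ∈ X` starts an injective chain `p x` of
non-relays from `p x 0 = x` avoiding `o`, distinct chains vertex-disjoint; for `x ∉ F` the chain condition holds at every
chain vertex (a plain leg, relay hairs arbitrary), for `x ∈ F` below the tip `p x (k x)` (`k x ≥ 1`), and the tip carries a
FORK: two pendant stars `y x ≠ z x` (non-relays off all chains and all other forks, positive pairs only towards
`A ∪ {tip}`), the tip's other positive pairs going to relays, its chain and `o` only.  If for every fork, with
`K_x := G ∖ ({o} ∪ leg_x) = restrW (insert o (range (p x)))ᶜ w` and `a₀ x ∈ A` minimising `P_{K_x}(· ↔ b)`, the gluing inequality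
`GC(y x, z x)` holds in `K_x + y z`, then the Steiner sets `L x` (chain ∪ fork; `∅` for relays) satisfy all unit hypotheses of
`goodUnits_gluing` and every unit is Kozma–Nitzan-good in `G − o` (`knGood_of_chain`, `knGood_of_chain_fork`). [this work] -/
theorem forkedSpider_units (w : Sym2 (Fin n) → unitInterval) (A X F : Finset (Fin n)) (hA : A.Nonempty)
    (o b : Fin n) (hb : b ∈ A) (hFA : ∀ x ∈ F, x ∉ A)
    (k : Fin n → ℕ) (p : ∀ x : Fin n, Fin (k x + 1) → Fin n)
    (hp0 : ∀ x ∈ X, x ∉ A → p x 0 = x) (hpinj : ∀ x ∈ X, x ∉ A → Function.Injective (p x))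
    (hpA : ∀ x ∈ X, x ∉ A → ∀ i, p x i ∉ A) (hpo : ∀ x ∈ X, x ∉ A → ∀ i, p x i ≠ o)
    (hchain : ∀ x ∈ X, x ∉ A → ∀ (i : Fin (k x + 1)) (u : Fin n), (x ∈ F → i.val < k x) → u ∉ A → u ≠ p x i →
      u ≠ o → w s(p x i, u) ≠ 0 → ∃ l : Fin (k x + 1), u = p x l ∧ (l.val = i.val + 1 ∨ i.val = l.val + 1))
    (hlegs : ∀ x ∈ X, ∀ x' ∈ X, x ≠ x' → x ∉ A → x' ∉ A → ∀ i j, p x i ≠ p x' j)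
    (y z : Fin n → Fin n) (hk : ∀ x ∈ F, 1 ≤ k x)
    (hyA : ∀ x ∈ F, y x ∉ A) (hzA : ∀ x ∈ F, z x ∉ A) (hyz : ∀ x ∈ F, y x ≠ z x)
    (hyo : ∀ x ∈ F, y x ≠ o) (hzo : ∀ x ∈ F, z x ≠ o)
    (hyp : ∀ x ∈ F, ∀ x' ∈ X, x' ∉ A → ∀ i, y x ≠ p x' i) (hzp : ∀ x ∈ F, ∀ x' ∈ X, x' ∉ A → ∀ i, z x ≠ p x' i)
    (hyy : ∀ x ∈ F, ∀ x' ∈ F, x ≠ x' → y x ≠ y x') (hyz' : ∀ x ∈ F, ∀ x' ∈ F, x ≠ x' → y x ≠ z x')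
    (hzz : ∀ x ∈ F, ∀ x' ∈ F, x ≠ x' → z x ≠ z x')
    (htipN : ∀ x ∈ F, ∀ u : Fin n, u ≠ o → u ∉ A → u ≠ y x → u ≠ z x → (∀ i, u ≠ p x i) →
      w s(p x (Fin.last (k x)), u) = 0)
    (hyN : ∀ x ∈ F, ∀ u : Fin n, u ≠ y x → u ∉ A → u ≠ o → u ≠ p x (Fin.last (k x)) → w s(y x, u) = 0)
    (hzN : ∀ x ∈ F, ∀ u : Fin n, u ≠ z x → u ∉ A → u ≠ o → u ≠ p x (Fin.last (k x)) → w s(z x, u) = 0)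
    (a₀ : Fin n → Fin n) (ha₀ : ∀ x ∈ F, a₀ x ∈ A)
    (hmin : ∀ x ∈ F, ∀ a ∈ A,
      (prodBernoulli (restrW (insert o (Set.range (p x)))ᶜ w)).real (openConn (a₀ x) b) ≤
      (prodBernoulli (restrW (insert o (Set.range (p x)))ᶜ w)).real (openConn a b))
    (hGC : ∀ x ∈ F,
      (prodBernoulli (Function.update (restrW (insert o (Set.range (p x)))ᶜ w) s(y x, z x) 1)).real
          (openConn (a₀ x) b) ≤
      (prodBernoulli (Function.update (restrW (insert o (Set.range (p x)))ᶜ w) s(y x, z x) 1)).real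
          (openConn (y x) b) +
        ∑ W ∈ nullSets A,
          (prodBernoulli (Function.update (restrW (insert o (Set.range (p x)))ᶜ w) s(y x, z x) 1)).real
              (clusterIs (y x) W) *
            A.inf' hA (fun a' =>
              (prodBernoulli (Function.update (restrW (insert o (Set.range (p x)))ᶜ w) s(y x, z x) 1)).real
                (openConnIn ((↑W : Set (Fin n))ᶜ) a' b))) :
    ∃ L : Fin n → Finset (Fin n), (∀ x ∈ X, x ∉ A → x ∈ L x) ∧ (∀ x ∈ X, o ∉ L x) ∧
      (∀ x ∈ X, Disjoint (L x) A) ∧ (∀ x ∈ X, ∀ x' ∈ X, x ≠ x' → Disjoint (L x) (L x')) ∧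
      (∀ x ∈ X, ∀ u ∈ L x, ∀ v, v ∉ L x → v ∉ A → v ≠ o → w s(u, v) = 0) ∧
      (∀ x ∈ X, x ∉ A → KNGood (restrW (({o} : Set (Fin n))ᶜ) w) A hA x b) := by
  set L : Fin n → Finset (Fin n) := fun x =>
    if x ∈ A then ∅ else Finset.univ.filter (fun v => (∃ i, v = p x i) ∨ (x ∈ F ∧ (v = y x ∨ v = z x))) with hL
  have memL : ∀ x, x ∉ A → ∀ v, v ∈ L x ↔ (∃ i, v = p x i) ∨ (x ∈ F ∧ (v = y x ∨ v = z x)) := by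
    intro x hxA v
    simp [hL, hxA]
  have LA : ∀ x, x ∈ A → L x = ∅ := by
    intro x hxA
    simp [hL, hxA]
  have tipL : ∀ x, x ∉ A → p x (Fin.last (k x)) ∈ L x := fun x hxA => (memL x hxA _).2 (Or.inl ⟨_, rfl⟩)
  have yL : ∀ x ∈ F, y x ∈ L x := fun x hx => (memL x (hFA x hx) _).2 (Or.inr ⟨hx, Or.inl rfl⟩)
  have zL : ∀ x ∈ F, z x ∈ L x := fun x hx => (memL x (hFA x hx) _).2 (Or.inr ⟨hx, Or.inr rfl⟩)
  refine ⟨L, ?_, ?_, ?_, ?_, ?_, ?_⟩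
  · intro x hx hxA
    rw [memL x hxA]
    exact Or.inl ⟨0, (hp0 x hx hxA).symm⟩
  · intro x hx hoLx
    by_cases hxA : x ∈ A
    · rw [LA x hxA] at hoLx; simp at hoLx
    · rcases (memL x hxA o).1 hoLx with ⟨i, hi⟩ | ⟨hxF, rfl | rfl⟩
      · exact hpo x hx hxA i hi.symm
      · exact hyo _ hxF rfl
      · exact hzo _ hxF rfl
  · intro x hx
    by_cases hxA : x ∈ A
    · rw [LA x hxA]; exact Finset.disjoint_empty_left A
    · rw [Finset.disjoint_left]
      intro v hv hvA
      rcases (memL x hxA v).1 hv with ⟨i, rfl⟩ | ⟨hxF, rfl | rfl⟩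
      · exact hpA x hx hxA i hvA
      · exact hyA x hxF hvA
      · exact hzA x hxF hvA
  · intro x hx x' hx' hxx'
    by_cases hxA : x ∈ A
    · rw [LA x hxA]; exact Finset.disjoint_empty_left _
    by_cases hx'A : x' ∈ A
    · rw [LA x' hx'A]; exact Finset.disjoint_empty_right _
    rw [Finset.disjoint_left]
    intro v hv hv'
    rcases (memL x hxA v).1 hv with ⟨i, rfl⟩ | ⟨hxF, rfl | rfl⟩
    · rcases (memL x' hx'A _).1 hv' with ⟨j, hj⟩ | ⟨hx'F, h | h⟩
      · exact hlegs x hx x' hx' hxx' hxA hx'A i j hj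
      · exact hyp x' hx'F x hx hxA i h.symm
      · exact hzp x' hx'F x hx hxA i h.symm
    · rcases (memL x' hx'A _).1 hv' with ⟨j, hj⟩ | ⟨hx'F, h | h⟩
      · exact hyp x hxF x' hx' hx'A j hj
      · exact hyy x hxF x' hx'F hxx' h
      · exact hyz' x hxF x' hx'F hxx' h
    · rcases (memL x' hx'A _).1 hv' with ⟨j, hj⟩ | ⟨hx'F, h | h⟩
      · exact hzp x hxF x' hx' hx'A j hj
      · exact hyz' x' hx'F x hxF (Ne.symm hxx') h.symm
      · exact hzz x hxF x' hx'F hxx' h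
  · intro x hx u hu v hvL hvA hvo
    by_cases hxA : x ∈ A
    · rw [LA x hxA] at hu; simp at hu
    · by_contra hne
      rcases (memL x hxA u).1 hu with ⟨i, rfl⟩ | ⟨hxF, rfl | rfl⟩
      · by_cases hik : x ∈ F → i.val < k x
        · by_cases hvu : v = p x i
          · exact hvL ((memL x hxA v).2 (Or.inl ⟨i, hvu⟩))
          · obtain ⟨l, rfl, _⟩ := hchain x hx hxA i v hik hvA hvu hvo hne
            exact hvL ((memL x hxA _).2 (Or.inl ⟨l, rfl⟩))
        · -- `u` is the tip of a forked leg
          have hxF : x ∈ F := by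
            by_contra hxF; exact hik fun h => absurd h hxF
          have hil : i = Fin.last (k x) := by
            apply Fin.ext
            rw [Fin.val_last]
            have := i.isLt
            by_contra hne'
            exact hik fun _ => by omega
          rw [hil] at hne
          refine hne (htipN x hxF v hvo hvA ?_ ?_ ?_)
          · rintro rfl; exact hvL (yL x hxF)
          · rintro rfl; exact hvL (zL x hxF)
          · intro j hj; exact hvL ((memL x hxA v).2 (Or.inl ⟨j, hj⟩))
      · refine hne (hyN x hxF v ?_ hvA hvo ?_)
        · rintro rfl; exact hvL (yL x hxF)
        · rintro rfl; exact hvL (tipL x hxA)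
      · refine hne (hzN x hxF v ?_ hvA hvo ?_)
        · rintro rfl; exact hvL (zL x hxF)
        · rintro rfl; exact hvL (tipL x hxA)
  · intro x hx hxA
    set w' := restrW (({o} : Set (Fin n))ᶜ) w with hw'
    have hw'o : ∀ u : Fin n, w' s(u, o) = 0 := fun u =>
      restrW_apply_of_not_mem w fun h => (mk_mem_wireSet_iff.1 h).2.1 rfl
    have hw'le : ∀ e, w' e ≤ w e := fun e => restrW_le _ w e
    have hw'zero : ∀ e, w e = 0 → w' e = 0 := fun e he => le_antisymm ((hw'le e).trans he.le) bot_le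
    have hw'ne : ∀ e, w' e ≠ 0 → w e ≠ 0 := fun e he h0 => he (hw'zero e h0)
    by_cases hxF : x ∈ F
    · -- a forked leg
      have hset : restrW (Set.range (p x))ᶜ w' = restrW (insert o (Set.range (p x)))ᶜ w := by
        rw [hw', restrW_restrW, Set.insert_eq, Set.compl_union, Set.inter_comm]
      have key := knGood_of_chain_fork A hA b hb (k x) (hk x hxF) w' (p x) (hpinj x hx hxA) (hpA x hx hxA) ?_
        (y x) (z x) (hyA x hxF) (hzA x hxF) (hyz x hxF) (hyp x hxF x hx hxA) (hzp x hxF x hx hxA) ?_ ?_ ?_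
        (a₀ x) (ha₀ x hxF) (by rw [hset]; exact hmin x hxF) (by rw [hset]; exact hGC x hxF)
      · rw [hp0 x hx hxA] at key
        exact key
      · intro i u hik huA hui hw0
        have huo : u ≠ o := by rintro rfl; exact hw0 (hw'o _)
        exact hchain x hx hxA i u (fun _ => hik) huA hui huo (hw'ne _ hw0)
      · intro u huA huy huz hup
        by_cases huo : u = o
        · rw [huo]; exact hw'o _
        · exact hw'zero _ (htipN x hxF u huo huA huy huz hup)
      · intro u huy huA hut
        by_cases huo : u = o
        · rw [huo]; exact hw'o _
        · exact hw'zero _ (hyN x hxF u huy huA huo hut)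
      · intro u huz huA hut
        by_cases huo : u = o
        · rw [huo]; exact hw'o _
        · exact hw'zero _ (hzN x hxF u huz huA huo hut)
    · -- a plain leg
      have key := knGood_of_chain A hA b hb (k x) w' (p x) (hpinj x hx hxA) (hpA x hx hxA) ?_
      · rw [hp0 x hx hxA] at key
        exact key
      · intro i u huA hui hw0
        have huo : u ≠ o := by rintro rfl; exact hw0 (hw'o _)
        exact hchain x hx hxA i u (fun h => absurd h hxF) huA hui huo (hw'ne _ hw0)

/-- **FORKED-SPIDER GLUING, `H`-form.**  `o ∉ A ∋ b`; every neighbour of `o` lies in `X ∌ o`; the non-relay neighbours start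
vertex-disjoint legs — plain legs (chains of non-relays with arbitrary relay hairs, as in `spider_gluing`) for `x ∉ F`, and for
`x ∈ F` legs of length `k x ≥ 1` whose tip carries a FORK of two pendant relay-stars `y x ≠ z x` (hypotheses as in
`forkedSpider_units`); `o` may also touch relays; relay side arbitrary.  ASSUME GC at every fork (in `G ∖ ({o} ∪ leg_x) + y z`,
at a minimiser `a₀ x` of `P_{G ∖ ({o} ∪ leg_x)}(· ↔ b)`).  If `μ(a ↮ b off o) ≤ t` for all relays then for every `θ > 0`:
`μ({o ↔ A} ∩ {o ↮ b}) ≤ θ + t/θ` — uniformly in the number of legs, their lengths, the forks' ports and `|A|`.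
So on the whole tree line "spiders whose legs end in forks" the two-lonely-children gluing inequality GC (LEAD-GEN7 §3a) is the
ONLY hypothesis left. [this work] -/
theorem forkedSpider_gluing (w : Sym2 (Fin n) → unitInterval) (A X F : Finset (Fin n)) (hA : A.Nonempty)
    (o b : Fin n) (hoA : o ∉ A) (hb : b ∈ A) (hoX : o ∉ X)
    (hX : ∀ y, y ≠ o → w s(o, y) ≠ 0 → y ∈ X) (hFA : ∀ x ∈ F, x ∉ A)
    (k : Fin n → ℕ) (p : ∀ x : Fin n, Fin (k x + 1) → Fin n)
    (hp0 : ∀ x ∈ X, x ∉ A → p x 0 = x) (hpinj : ∀ x ∈ X, x ∉ A → Function.Injective (p x))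
    (hpA : ∀ x ∈ X, x ∉ A → ∀ i, p x i ∉ A) (hpo : ∀ x ∈ X, x ∉ A → ∀ i, p x i ≠ o)
    (hchain : ∀ x ∈ X, x ∉ A → ∀ (i : Fin (k x + 1)) (u : Fin n), (x ∈ F → i.val < k x) → u ∉ A → u ≠ p x i →
      u ≠ o → w s(p x i, u) ≠ 0 → ∃ l : Fin (k x + 1), u = p x l ∧ (l.val = i.val + 1 ∨ i.val = l.val + 1))
    (hlegs : ∀ x ∈ X, ∀ x' ∈ X, x ≠ x' → x ∉ A → x' ∉ A → ∀ i j, p x i ≠ p x' j)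
    (y z : Fin n → Fin n) (hk : ∀ x ∈ F, 1 ≤ k x)
    (hyA : ∀ x ∈ F, y x ∉ A) (hzA : ∀ x ∈ F, z x ∉ A) (hyz : ∀ x ∈ F, y x ≠ z x)
    (hyo : ∀ x ∈ F, y x ≠ o) (hzo : ∀ x ∈ F, z x ≠ o)
    (hyp : ∀ x ∈ F, ∀ x' ∈ X, x' ∉ A → ∀ i, y x ≠ p x' i) (hzp : ∀ x ∈ F, ∀ x' ∈ X, x' ∉ A → ∀ i, z x ≠ p x' i)
    (hyy : ∀ x ∈ F, ∀ x' ∈ F, x ≠ x' → y x ≠ y x') (hyz' : ∀ x ∈ F, ∀ x' ∈ F, x ≠ x' → y x ≠ z x')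
    (hzz : ∀ x ∈ F, ∀ x' ∈ F, x ≠ x' → z x ≠ z x')
    (htipN : ∀ x ∈ F, ∀ u : Fin n, u ≠ o → u ∉ A → u ≠ y x → u ≠ z x → (∀ i, u ≠ p x i) →
      w s(p x (Fin.last (k x)), u) = 0)
    (hyN : ∀ x ∈ F, ∀ u : Fin n, u ≠ y x → u ∉ A → u ≠ o → u ≠ p x (Fin.last (k x)) → w s(y x, u) = 0)
    (hzN : ∀ x ∈ F, ∀ u : Fin n, u ≠ z x → u ∉ A → u ≠ o → u ≠ p x (Fin.last (k x)) → w s(z x, u) = 0)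
    (a₀ : Fin n → Fin n) (ha₀ : ∀ x ∈ F, a₀ x ∈ A)
    (hmin : ∀ x ∈ F, ∀ a ∈ A,
      (prodBernoulli (restrW (insert o (Set.range (p x)))ᶜ w)).real (openConn (a₀ x) b) ≤
      (prodBernoulli (restrW (insert o (Set.range (p x)))ᶜ w)).real (openConn a b))
    (hGC : ∀ x ∈ F,
      (prodBernoulli (Function.update (restrW (insert o (Set.range (p x)))ᶜ w) s(y x, z x) 1)).real
          (openConn (a₀ x) b) ≤
      (prodBernoulli (Function.update (restrW (insert o (Set.range (p x)))ᶜ w) s(y x, z x) 1)).real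
          (openConn (y x) b) +
        ∑ W ∈ nullSets A,
          (prodBernoulli (Function.update (restrW (insert o (Set.range (p x)))ᶜ w) s(y x, z x) 1)).real
              (clusterIs (y x) W) *
            A.inf' hA (fun a' =>
              (prodBernoulli (Function.update (restrW (insert o (Set.range (p x)))ᶜ w) s(y x, z x) 1)).real
                (openConnIn ((↑W : Set (Fin n))ᶜ) a' b)))
    (t : ℝ) (ht0 : 0 ≤ t)
    (ht : ∀ a ∈ A, (prodBernoulli w).real (openConnIn (({o} : Set (Fin n))ᶜ) a b)ᶜ ≤ t)
    (θ : ℝ) (hθ : 0 < θ) :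
    (prodBernoulli w).real ((⋃ a ∈ A, (openConn o a : Set (BondConfig (Fin n)))) ∩ (openConn o b)ᶜ) ≤
      θ + t / θ := by
  obtain ⟨L, hxL, hoL, hLA, hLL, hclos, hgood⟩ :=
    forkedSpider_units w A X F hA o b hb hFA k p hp0 hpinj hpA hpo hchain hlegs y z hk hyA hzA hyz hyo hzo hyp hzp hyy hyz' hzz htipN hyN hzN a₀ ha₀ hmin hGC
  exact goodUnits_gluing w A X hA o b hoA hb hoX hX L hxL hoL hLA hLL hclos hgood t ht0 ht θ hθ

/-- **FORKED-SPIDER GLUING, `G`-form (Kozma–Nitzan Conjecture 3 on forked spiders, modulo GC at the forks).**  Under the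
structural hypotheses of `forkedSpider_gluing` and GC at every fork: if `μ(a ↮ b) ≤ t` for every relay IN `G`, then
`μ(o ↮ b) ≤ μ(o ↮ A) + 2·t^{1/4}` (bridge through the hub inequality, `goodUnits_nearOneGluing`). [this work] -/
theorem forkedSpider_nearOneGluing (w : Sym2 (Fin n) → unitInterval) (A X F : Finset (Fin n)) (hA : A.Nonempty)
    (o b : Fin n) (hoA : o ∉ A) (hb : b ∈ A) (hoX : o ∉ X)
    (hX : ∀ y, y ≠ o → w s(o, y) ≠ 0 → y ∈ X) (hFA : ∀ x ∈ F, x ∉ A)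
    (k : Fin n → ℕ) (p : ∀ x : Fin n, Fin (k x + 1) → Fin n)
    (hp0 : ∀ x ∈ X, x ∉ A → p x 0 = x) (hpinj : ∀ x ∈ X, x ∉ A → Function.Injective (p x))
    (hpA : ∀ x ∈ X, x ∉ A → ∀ i, p x i ∉ A) (hpo : ∀ x ∈ X, x ∉ A → ∀ i, p x i ≠ o)
    (hchain : ∀ x ∈ X, x ∉ A → ∀ (i : Fin (k x + 1)) (u : Fin n), (x ∈ F → i.val < k x) → u ∉ A → u ≠ p x i →
      u ≠ o → w s(p x i, u) ≠ 0 → ∃ l : Fin (k x + 1), u = p x l ∧ (l.val = i.val + 1 ∨ i.val = l.val + 1))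
    (hlegs : ∀ x ∈ X, ∀ x' ∈ X, x ≠ x' → x ∉ A → x' ∉ A → ∀ i j, p x i ≠ p x' j)
    (y z : Fin n → Fin n) (hk : ∀ x ∈ F, 1 ≤ k x)
    (hyA : ∀ x ∈ F, y x ∉ A) (hzA : ∀ x ∈ F, z x ∉ A) (hyz : ∀ x ∈ F, y x ≠ z x)
    (hyo : ∀ x ∈ F, y x ≠ o) (hzo : ∀ x ∈ F, z x ≠ o)
    (hyp : ∀ x ∈ F, ∀ x' ∈ X, x' ∉ A → ∀ i, y x ≠ p x' i) (hzp : ∀ x ∈ F, ∀ x' ∈ X, x' ∉ A → ∀ i, z x ≠ p x' i)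
    (hyy : ∀ x ∈ F, ∀ x' ∈ F, x ≠ x' → y x ≠ y x') (hyz' : ∀ x ∈ F, ∀ x' ∈ F, x ≠ x' → y x ≠ z x')
    (hzz : ∀ x ∈ F, ∀ x' ∈ F, x ≠ x' → z x ≠ z x')
    (htipN : ∀ x ∈ F, ∀ u : Fin n, u ≠ o → u ∉ A → u ≠ y x → u ≠ z x → (∀ i, u ≠ p x i) →
      w s(p x (Fin.last (k x)), u) = 0)
    (hyN : ∀ x ∈ F, ∀ u : Fin n, u ≠ y x → u ∉ A → u ≠ o → u ≠ p x (Fin.last (k x)) → w s(y x, u) = 0)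
    (hzN : ∀ x ∈ F, ∀ u : Fin n, u ≠ z x → u ∉ A → u ≠ o → u ≠ p x (Fin.last (k x)) → w s(z x, u) = 0)
    (a₀ : Fin n → Fin n) (ha₀ : ∀ x ∈ F, a₀ x ∈ A)
    (hmin : ∀ x ∈ F, ∀ a ∈ A,
      (prodBernoulli (restrW (insert o (Set.range (p x)))ᶜ w)).real (openConn (a₀ x) b) ≤
      (prodBernoulli (restrW (insert o (Set.range (p x)))ᶜ w)).real (openConn a b))
    (hGC : ∀ x ∈ F,
      (prodBernoulli (Function.update (restrW (insert o (Set.range (p x)))ᶜ w) s(y x, z x) 1)).real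
          (openConn (a₀ x) b) ≤
      (prodBernoulli (Function.update (restrW (insert o (Set.range (p x)))ᶜ w) s(y x, z x) 1)).real
          (openConn (y x) b) +
        ∑ W ∈ nullSets A,
          (prodBernoulli (Function.update (restrW (insert o (Set.range (p x)))ᶜ w) s(y x, z x) 1)).real
              (clusterIs (y x) W) *
            A.inf' hA (fun a' =>
              (prodBernoulli (Function.update (restrW (insert o (Set.range (p x)))ᶜ w) s(y x, z x) 1)).real
                (openConnIn ((↑W : Set (Fin n))ᶜ) a' b)))
    (t : ℝ) (hrel : ∀ a ∈ A, (prodBernoulli w).real (openConn a b : Set (BondConfig (Fin n)))ᶜ ≤ t) :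
    (prodBernoulli w).real (openConn o b : Set (BondConfig (Fin n)))ᶜ ≤
      (prodBernoulli w).real (⋃ a ∈ A, (openConn o a : Set (BondConfig (Fin n))))ᶜ +
        2 * Real.sqrt (Real.sqrt t) := by
  obtain ⟨L, hxL, hoL, hLA, hLL, hclos, hgood⟩ :=
    forkedSpider_units w A X F hA o b hb hFA k p hp0 hpinj hpA hpo hchain hlegs y z hk hyA hzA hyz hyo hzo hyp hzp hyy hyz' hzz htipN hyN hzN a₀ ha₀ hmin hGC
  exact goodUnits_nearOneGluing w A X hA o b hoA hb hoX hX L hxL hoL hLA hLL hclos hgood t hrel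

/-- **Kozma–Nitzan Conjecture 3 on FORKED SPIDERS in `ε–δ` form with explicit `δ_ε = min(ε/2, (ε/4)^4)`, modulo GC at the
forks.**  For every `ε > 0`, every `n`, weights, relays `A ∋ b`, observer `o ∉ A` and forked-spider structure as in
`forkedSpider_gluing` with GC at every fork: `μ(o ↔ A) > 1 − δ_ε` and `μ(a ↔ b) > 1 − δ_ε` for all relays imply
`μ(o ↔ b) > 1 − ε` — manifestly uniform in `n`, the number of legs, their lengths, the forks and `|A|`.  (The wording of the
crux `NearOneGluing` on this class; GC = the two-lonely-children kernel is the only non-structural hypothesis.) [this work] -/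
theorem forkedSpider_conjecture3_explicit (ε : ℝ) (hε : 0 < ε) (w : Sym2 (Fin n) → unitInterval)
    (A X F : Finset (Fin n)) (o b : Fin n) (hoA : o ∉ A) (hb : b ∈ A) (hoX : o ∉ X)
    (hX : ∀ y, y ≠ o → w s(o, y) ≠ 0 → y ∈ X) (hFA : ∀ x ∈ F, x ∉ A)
    (k : Fin n → ℕ) (p : ∀ x : Fin n, Fin (k x + 1) → Fin n)
    (hp0 : ∀ x ∈ X, x ∉ A → p x 0 = x) (hpinj : ∀ x ∈ X, x ∉ A → Function.Injective (p x))
    (hpA : ∀ x ∈ X, x ∉ A → ∀ i, p x i ∉ A) (hpo : ∀ x ∈ X, x ∉ A → ∀ i, p x i ≠ o)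
    (hchain : ∀ x ∈ X, x ∉ A → ∀ (i : Fin (k x + 1)) (u : Fin n), (x ∈ F → i.val < k x) → u ∉ A → u ≠ p x i →
      u ≠ o → w s(p x i, u) ≠ 0 → ∃ l : Fin (k x + 1), u = p x l ∧ (l.val = i.val + 1 ∨ i.val = l.val + 1))
    (hlegs : ∀ x ∈ X, ∀ x' ∈ X, x ≠ x' → x ∉ A → x' ∉ A → ∀ i j, p x i ≠ p x' j)
    (y z : Fin n → Fin n) (hk : ∀ x ∈ F, 1 ≤ k x)
    (hyA : ∀ x ∈ F, y x ∉ A) (hzA : ∀ x ∈ F, z x ∉ A) (hyz : ∀ x ∈ F, y x ≠ z x)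
    (hyo : ∀ x ∈ F, y x ≠ o) (hzo : ∀ x ∈ F, z x ≠ o)
    (hyp : ∀ x ∈ F, ∀ x' ∈ X, x' ∉ A → ∀ i, y x ≠ p x' i) (hzp : ∀ x ∈ F, ∀ x' ∈ X, x' ∉ A → ∀ i, z x ≠ p x' i)
    (hyy : ∀ x ∈ F, ∀ x' ∈ F, x ≠ x' → y x ≠ y x') (hyz' : ∀ x ∈ F, ∀ x' ∈ F, x ≠ x' → y x ≠ z x')
    (hzz : ∀ x ∈ F, ∀ x' ∈ F, x ≠ x' → z x ≠ z x')
    (htipN : ∀ x ∈ F, ∀ u : Fin n, u ≠ o → u ∉ A → u ≠ y x → u ≠ z x → (∀ i, u ≠ p x i) →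
      w s(p x (Fin.last (k x)), u) = 0)
    (hyN : ∀ x ∈ F, ∀ u : Fin n, u ≠ y x → u ∉ A → u ≠ o → u ≠ p x (Fin.last (k x)) → w s(y x, u) = 0)
    (hzN : ∀ x ∈ F, ∀ u : Fin n, u ≠ z x → u ∉ A → u ≠ o → u ≠ p x (Fin.last (k x)) → w s(z x, u) = 0)
    (a₀ : Fin n → Fin n) (ha₀ : ∀ x ∈ F, a₀ x ∈ A)
    (hmin : ∀ x ∈ F, ∀ a ∈ A,
      (prodBernoulli (restrW (insert o (Set.range (p x)))ᶜ w)).real (openConn (a₀ x) b) ≤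
      (prodBernoulli (restrW (insert o (Set.range (p x)))ᶜ w)).real (openConn a b))
    (hGC : ∀ x ∈ F,
      (prodBernoulli (Function.update (restrW (insert o (Set.range (p x)))ᶜ w) s(y x, z x) 1)).real
          (openConn (a₀ x) b) ≤
      (prodBernoulli (Function.update (restrW (insert o (Set.range (p x)))ᶜ w) s(y x, z x) 1)).real
          (openConn (y x) b) +
        ∑ W ∈ nullSets A,
          (prodBernoulli (Function.update (restrW (insert o (Set.range (p x)))ᶜ w) s(y x, z x) 1)).real
              (clusterIs (y x) W) *
            A.inf' ⟨b, hb⟩ (fun a' =>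
              (prodBernoulli (Function.update (restrW (insert o (Set.range (p x)))ᶜ w) s(y x, z x) 1)).real
                (openConnIn ((↑W : Set (Fin n))ᶜ) a' b)))
    (hoA' : 1 - min (ε / 2) ((ε / 4) ^ 4) < (prodBernoulli w).real (⋃ a ∈ A, (openConn o a : Set (BondConfig (Fin n)))))
    (hrel' : ∀ a ∈ A, 1 - min (ε / 2) ((ε / 4) ^ 4) < (prodBernoulli w).real (openConn a b : Set (BondConfig (Fin n)))) :
    1 - ε < (prodBernoulli w).real (openConn o b : Set (BondConfig (Fin n))) := by
  obtain ⟨L, hxL, hoL, hLA, hLL, hclos, hgood⟩ :=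
    forkedSpider_units w A X F ⟨b, hb⟩ o b hb hFA k p hp0 hpinj hpA hpo hchain hlegs y z hk hyA hzA hyz hyo hzo hyp hzp hyy hyz' hzz htipN hyN hzN a₀ ha₀ hmin hGC
  exact goodUnits_conjecture3_explicit ε hε w A X ⟨b, hb⟩ o b hoA hb hoX hX L hxL hoL hLA hLL hclos hgood hoA' hrel'

end SpiderGluing

end

end Summit.CriticalPhenomena.PercolationContinuityZ3.Theorems
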